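/-
Copyright (c) 2026 the pub-hodgecm-mathlib formalisation cell (harness21).  Prover seat hodgecm-mathlib-K2E3-p21 (g5), Track B «K2-LIT» ∕ h413
(`stmt-HodgeConjecture-24833`), line `K2_E3_EllipticInputs`, unit U12 §L, road «GL-[M6]-sc» (line lead K2E3-p23 (g5), (M16-2) «per-point `hcanc` with explicit radius»;
T20-GL₃ co-owned with K2E5-p17 (g4)), brick T20-GL₃ (C-shell B), FILE 3: «SUPPORT OF THE SUPERCUSPIDAL SLICE AND THE PER-POINT `hcanc` AT A MIXED REGULAR CLASS
(`Γ = T_E = E^× × F^×`) OF `G' = GL₃(F) ⧸ ϖ^ℤ·1`» = ★ (C) `…_blockScalar` ∘ ★ (C-shell A) ∘ ★ B4-E1 ∘ ★ T18-mixed ∘ ★ mixed glue.  2026-09-04.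
-/
import Summits.HodgeConjecture.HodgeConjecture.Theorems.K2E3GL3SupercuspOrbitalSliceCancellation   -- ★ (C-shell B) FILE 2 (this seat): `exists_support_height`; brings ★ FILE 1, ★ (C-shell A)
import Summits.HodgeConjecture.HodgeConjecture.Theorems.K2E3GL3CuspFormCancellationBlockScalar     -- ★ (C) sequel (K2E5-p17 g4): `cuspForm_cancellation_GL3_blockScalar`
import Summits.HodgeConjecture.HodgeConjecture.Theorems.K2E3GL3MixedCentralizerSupport             -- ★ glue (K2E5-p17 g4): `mem_adBall_mul_A₃_of_comm`; brings ★ T18-mixed (K2E3-p14 g5)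
import Summits.HodgeConjecture.HodgeConjecture.Theorems.K2E3GL3MixedConjugacyVolume                -- ★ (K2E3-p14 g5): `leviBlock_mem_standardLeviGL` (the companion matrix lies in `M_{(2,1)}`)
import HarnessLib

/-!
# K2_E3 road (h413), T20-GL₃ (C-shell B, file 3): the per-point `hcanc` at a MIXED regular class `ḡ = mk (y γ y⁻¹)`, `γ = !![0, −N, 0; 1, T, 0; 0, 0, c]`
# (`π = X² − TX + N` without a root in `F`), radius `R = m_C + (1 + 2s + 4 m_C) + s`, `m_C = 9 s₀ + L + L_d`

Cell `pub/hodgecm-mathlib` (D-0151), Track B, seat K2E3-p21 (g5).  CONSUMER: ASM (K2E3-p23 (g5), (M16-2) per-point form), mixed branch of ★ ASM-core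
`nonEllEstimates_of_radius`'s `hcanc`.  `--supports stmt-HodgeConjecture-24833 --as helper`; THEOREMS ONLY (no `def`, no instance, no notation, no `sorry`).

* §0 (algebra) **`v_pow_mul_apply_le_one_of_adBall`**: `𝔅_s(w)` and `|det w| ≤ 1` force `ϖ^s w` INTEGRAL (`(ϖ^s w_{ij})³ · det w⁻¹` is the determinant of the integral
  matrix `(ϖ^s w_{ij}) · w⁻¹`) — the bridge from the scale-invariant support condition `𝔅_{s₀}(zγz⁻¹)` to ★ T18-mixed's «integral conjugate» (its CAVEAT);
  **`coe_scalar_mul_zpowDiagGL_conj`**: `ϖ^s · DγD⁻¹`, `D = diag(ϖ^s, 1, 1)`, is again a companion matrix (`T ↦ ϖ^s T`, `N ↦ ϖ^{2s} N`, `c ↦ ϖ^s c`); `adBall_zpowDiagGL_single`.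
* §1 **`slice_support_subset_mixed`** — ★ `cuspForm_cancellation_GL3_blockScalar`'s binder `hsupp` with `m_C = 9s₀ + L + L_d` (`s₀` = support height of `θ`,
  `|ϖ^L| ≤ |D(γ)|`, `|ϖ^{L_d}| ≤ |T² − 4N|`): §0 ⇒ ★ T18-mixed at `(zD⁻¹, ϖ^{s₀}DγD⁻¹)` with `6s₀ + L` ⇒ ★ glue with `2s₀ + L_d` ⇒ `D` commutes past `A₃` (★
  `mul_comm_of_mem_standardLeviGL_id`) and `𝔅_{s₀}(D)`.
* §2 **`slice_hcusp21_mixed`**, **`slice_hcusp21bar_mixed`** — the two cusp binders of ★ `…_blockScalar` (carriers `![0,0,1]`, `![1,1,0] : Fin 3 → Fin 2`): ★ B4-E1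
  `integral_unipotentRadical21_conj_eq_zero_of_cuspForm` ∕ `integral_oppositeUnipotentRadical21_…` (regularity `π(c) ≠ 0`) fed by ★ B4-J FILE 4, `Bool → Fin 2` by ★ FILE 1 §1.
* §3 **`setIntegral_conj_eq_setIntegral_inter_mixed`** — for EVERY `n`: `∫_{Ω n} θ(x̄ ḡ x̄⁻¹) dμ' = ∫_{Ω n ∩ Ω R} θ(x̄ ḡ x̄⁻¹) dμ'`, `θ = B u' (ρ · u)`,
  `R = m_C + (1 + 2s + 4m_C) + s`; and **`exists_radius_setIntegral_conj_eq_setIntegral_inter_mixed`** (`∃ s₀, ∀ γ y …`).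
[HarishChandra1970, Part VII §2 Thm 18 p. 69 + Cor, Thm 20 p. 70, §3 pp. 71–73]; [Casselman1995, Thm. 5.3.1].

HONEST LABEL: HC_CM is proved only modulo the 7 printed citations (2 remaining named inputs: hLiu418 = `stmt-HodgeConjecture-24832`, h413 = `stmt-HodgeConjecture-24833`)
until rung 0 closes; this file is a count-neutral helper and closes no socket.

## References
* [HarishChandra1970] Harish-Chandra (notes by G. van Dijk), *Harmonic Analysis on Reductive p-adic Groups*, LNM 162 (1970), Part VII §2 Thm 18–20 pp. 69–70, §3 pp. 71–73.
* [Casselman1995] W. Casselman, *Introduction to the theory of admissible representations of `p`-adic reductive groups* (1995 notes), Thm. 5.3.1, Prop. 1.4.4.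
-/

set_option autoImplicit false
-- the mandated namespace repeats the single-problem summit's segment (`HodgeConjecture.HodgeConjecture`)
set_option linter.dupNamespace false

noncomputable section

open MeasureTheory MeasureTheory.Measure Set Filter Topology
open scoped MatrixGroups Pointwise WithZero
open Literature.NumberTheory.Automorphic Literature.NumberTheory.GaloisRepresentations Literature.NumberTheory.GaloisRepresentations.IsNonarchimedeanLocalField
open Summit.HodgeConjecture.HodgeConjecture.Cruxes.H413.K2E3GLnAdHeightBalls
open Summit.HodgeConjecture.HodgeConjecture.Cruxes.H413.K2E3GLnUnipotentExhaustion
open Summit.HodgeConjecture.HodgeConjecture.Cruxes.H413.K2E3GL3SupercuspidalCuspFormOppositeRadicals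
open Summit.HodgeConjecture.HodgeConjecture.Cruxes.H413.K2E3GLnCongruenceIwahoriTriple (unipotentRadicalGL_eq_of_forall_le_iff)
open Summit.HodgeConjecture.HodgeConjecture.Cruxes.H413.K2E3GL3CuspFormCancellationMaxParabolic
open Summit.HodgeConjecture.HodgeConjecture.Cruxes.H413.K2E3GL3CuspFormCancellationBlockScalar (cuspForm_cancellation_GL3_blockScalar)
open Summit.HodgeConjecture.HodgeConjecture.Cruxes.H413.K2E3GL3TruncatedCharMixedTorusRadius (det_conj_companion_eq exists_adBall_mul_centralizer_of_conj_integral_mixed)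
open Summit.HodgeConjecture.HodgeConjecture.Cruxes.H413.K2E3GL3MixedCentralizerSupport (mem_adBall_mul_A₃_of_comm)
open Summit.HodgeConjecture.HodgeConjecture.Cruxes.H413.K2E3GL3SupercuspOrbitalSliceCuspidal
open Summit.HodgeConjecture.HodgeConjecture.Cruxes.H413.K2E3GL3CuspFormCancellationShell
open Summit.HodgeConjecture.HodgeConjecture.Cruxes.H413.K2E3GL3SupercuspOrbitalSliceCancellation (exists_support_height)

namespace Summit.HodgeConjecture.HodgeConjecture.Cruxes.H413.K2E3GL3SupercuspOrbitalSliceCancellationMixed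

/-! ## §0  Algebra: integrality from `𝔅_s`, the rescaled companion class, `𝔅_s(diag(ϖ^s,1,1))` -/

section Algebra

variable {F : Type*} [Field F]

/-- **THE RESCALED COMPANION CLASS**: for `γ = !![0, −N, 0; 1, T, 0; 0, 0, c]` and `D = diag(ϖ^s, 1, 1)`, `ϖ^s · D γ D⁻¹ = !![0, −ϖ^{2s}N, 0; 1, ϖ^s T, 0; 0, 0, ϖ^s c]` — the companion
matrix of `X² − ϖ^sT X + ϖ^{2s}N` with `c ↦ ϖ^s c` (same class in `GL₃(F) ⧸ ϖ^ℤ·1`). [cite: HarishChandra1970, Part VII §3 p. 72] -/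
theorem coe_scalar_mul_zpowDiagGL_conj {ϖ : F} (hϖ0 : ϖ ≠ 0) {γ : GL (Fin 3) F} {T N c : F} (hγ : (γ : Matrix (Fin 3) (Fin 3) F) = !![0, -N, 0; 1, T, 0; 0, 0, c])
    (s : ℕ) :
    ((Matrix.GeneralLinearGroup.scalar (Fin 3) (Units.mk0 ϖ hϖ0 ^ s) *
        (zpowDiagGL (n := 3) hϖ0 ![(s : ℤ), 0, 0] * γ * (zpowDiagGL (n := 3) hϖ0 ![(s : ℤ), 0, 0])⁻¹) : GL (Fin 3) F) : Matrix (Fin 3) (Fin 3) F) =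
      !![0, -(ϖ ^ s * ϖ ^ s * N), 0; 1, ϖ ^ s * T, 0; 0, 0, ϖ ^ s * c] := by
  have hps : ϖ ^ s ≠ 0 := pow_ne_zero _ hϖ0
  ext i j
  rw [coe_scalar_mul_apply, coe_zpowDiagGL_mul_mul_inv_apply, Units.val_pow_eq_pow_val, Units.val_mk0, hγ]
  fin_cases i <;> fin_cases j <;> simp [zpow_natCast, hps, mul_assoc]

/-- **Regularity of the companion element in `M_{(2,1)}`**: `χ_{top-left}(γ₂₂) = c² − Tc + N = π(c)`. [cite: HarishChandra1970, Part VII §3 p. 72] -/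
theorem eval_charpoly_topLeft_of_coe_eq {γ : GL (Fin 3) F} {T N c : F} (hγ : (γ : Matrix (Fin 3) (Fin 3) F) = !![0, -N, 0; 1, T, 0; 0, 0, c]) :
    (!![(γ : Matrix (Fin 3) (Fin 3) F) 0 0, (γ : Matrix (Fin 3) (Fin 3) F) 0 1;
        (γ : Matrix (Fin 3) (Fin 3) F) 1 0, (γ : Matrix (Fin 3) (Fin 3) F) 1 1] : Matrix (Fin 2) (Fin 2) F).charpoly.eval
      ((γ : Matrix (Fin 3) (Fin 3) F) 2 2) = c ^ 2 - T * c + N := by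
  rw [eval_charpoly_fin_two, hγ]
  simp
  ring

variable [Valued F ℤᵐ⁰]

/-- **`𝔅_s(w)` AND `|det w| ≤ 1` FORCE `ϖ^s · w` INTEGRAL**: for each `(i,j)` the matrix `(ϖ^s w_{ij}) · w⁻¹` is integral (this is `𝔅_s(w)`), so its determinant
`(ϖ^s w_{ij})³ · (det w)⁻¹` is integral, i.e. `|ϖ^s w_{ij}|³ ≤ |det w| ≤ 1`. [cite: HarishChandra1970, Part VII §2 p. 69] -/
theorem v_pow_mul_apply_le_one_of_adBall {ϖ : F} {s : ℕ} {w : GL (Fin 3) F}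
    (h : ∀ i j k l, Valued.v (ϖ ^ s * ((w : Matrix (Fin 3) (Fin 3) F) i j * ((w⁻¹ : GL (Fin 3) F) : Matrix (Fin 3) (Fin 3) F) k l)) ≤ 1)
    (hdet : Valued.v ((w : Matrix (Fin 3) (Fin 3) F)).det ≤ 1) (i j : Fin 3) :
    Valued.v (ϖ ^ s * (w : Matrix (Fin 3) (Fin 3) F) i j) ≤ 1 := by
  have hZ : Valued.v ((ϖ ^ s * (w : Matrix (Fin 3) (Fin 3) F) i j) • ((w⁻¹ : GL (Fin 3) F) : Matrix (Fin 3) (Fin 3) F)).det ≤ 1 := by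
    have h1 := K2E3GL3FinConjBoxes.v_det_le_of_entries_le (M := 0) ((ϖ ^ s * (w : Matrix (Fin 3) (Fin 3) F) i j) • ((w⁻¹ : GL (Fin 3) F) : Matrix (Fin 3) (Fin 3) F))
      (fun k l => by rw [WithZero.exp_zero, Matrix.smul_apply, smul_eq_mul, mul_assoc]; exact h i j k l)
    rwa [mul_zero, WithZero.exp_zero] at h1
  have hdet' : ((ϖ ^ s * (w : Matrix (Fin 3) (Fin 3) F) i j) • ((w⁻¹ : GL (Fin 3) F) : Matrix (Fin 3) (Fin 3) F)).det * ((w : Matrix (Fin 3) (Fin 3) F)).det =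
      (ϖ ^ s * (w : Matrix (Fin 3) (Fin 3) F) i j) ^ 3 := by
    rw [Matrix.det_smul, Fintype.card_fin, mul_assoc, ← Matrix.det_mul, ← Units.val_mul, inv_mul_cancel, Units.val_one, Matrix.det_one, mul_one]
  have h3 : Valued.v (ϖ ^ s * (w : Matrix (Fin 3) (Fin 3) F) i j) ^ 3 ≤ 1 := by
    rw [← map_pow, ← hdet', map_mul]
    exact mul_le_one' hZ hdet
  exact (pow_le_one_iff (by norm_num)).1 h3

/-- **`𝔅_s(diag(ϖ^s, 1, 1))`** (torus reading ★ `adBall_iff_of_coe_eq_diagonal`). [cite: HarishChandra1970, Part VII §2 p. 69] -/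
theorem adBall_zpowDiagGL_single {ϖ : F} (hϖ : Valued.v ϖ = WithZero.exp (-1 : ℤ)) (hϖ0 : ϖ ≠ 0) (s : ℕ) :
    ∀ i j k l, Valued.v (ϖ ^ s * (((zpowDiagGL (n := 3) hϖ0 ![(s : ℤ), 0, 0] : GL (Fin 3) F) : Matrix (Fin 3) (Fin 3) F) i j *
      (((zpowDiagGL (n := 3) hϖ0 ![(s : ℤ), 0, 0])⁻¹ : GL (Fin 3) F) : Matrix (Fin 3) (Fin 3) F) k l)) ≤ 1 := by
  have h1 : Valued.v (ϖ ^ s) ≤ 1 := (map_pow _ _ _).trans_le (pow_le_one' (v_le_one_of_v_eq_exp hϖ) _)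
  have hps : ϖ ^ s ≠ 0 := pow_ne_zero _ hϖ0
  refine (adBall_iff_of_coe_eq_diagonal ϖ s (coe_zpowDiagGL hϖ0 _)).2 fun i j => ?_
  fin_cases i <;> fin_cases j <;>
    simp only [Fin.zero_eta, Fin.mk_one, Fin.reduceFinMk, Fin.isValue, Matrix.cons_val_zero, Matrix.cons_val_one, Matrix.cons_val,
      zpow_natCast, zpow_zero, inv_one, mul_one, one_mul, mul_inv_cancel₀ hps] <;>
    first | exact h1 | exact (map_one _).le | exact (map_mul _ _ _).trans_le (mul_le_one' h1 h1)

end Algebra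

variable {F : Type*} [Field F] [Valued F ℤᵐ⁰] [ValuativeRel F] [(Valued.v : Valuation F ℤᵐ⁰).Compatible] [IsNonarchimedeanLocalField F] [CharZero F]
  [MeasurableSpace F] [BorelSpace F] [MeasurableSpace (GL (Fin 3) F)] [BorelSpace (GL (Fin 3) F)]
  {ϖ : F} (hϖ : Valued.v ϖ = WithZero.exp (-1 : ℤ)) (hϖ0 : ϖ ≠ 0)
  [((Subgroup.zpowers (Units.mk0 ϖ hϖ0)).map (Matrix.GeneralLinearGroup.scalar (Fin 3))).Normal]
  [MeasurableSpace (GL (Fin 3) F ⧸ (Subgroup.zpowers (Units.mk0 ϖ hϖ0)).map (Matrix.GeneralLinearGroup.scalar (Fin 3)))]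
  [BorelSpace (GL (Fin 3) F ⧸ (Subgroup.zpowers (Units.mk0 ϖ hϖ0)).map (Matrix.GeneralLinearGroup.scalar (Fin 3)))]
  {V : Type*} [AddCommGroup V] [Module ℂ V] (ρ : Representation ℂ (GL (Fin 3) F ⧸ (Subgroup.zpowers (Units.mk0 ϖ hϖ0)).map (Matrix.GeneralLinearGroup.scalar (Fin 3))) V)
  (hρ : ρ.IsSmooth) (hsc : ρ.IsSupercuspidal) {B : V →ₗ⋆[ℂ] V →ₗ[ℂ] ℂ}
  (hBinv : ∀ (g : GL (Fin 3) F ⧸ (Subgroup.zpowers (Units.mk0 ϖ hϖ0)).map (Matrix.GeneralLinearGroup.scalar (Fin 3))) (v w : V), B (ρ g v) (ρ g w) = B v w) (u u' : V)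
  (Ω : CompactExhaustion (GL (Fin 3) F ⧸ (Subgroup.zpowers (Units.mk0 ϖ hϖ0)).map (Matrix.GeneralLinearGroup.scalar (Fin 3))))
  (hmem : ∀ (m : ℕ) (g : GL (Fin 3) F),
    (QuotientGroup.mk g : GL (Fin 3) F ⧸ (Subgroup.zpowers (Units.mk0 ϖ hϖ0)).map (Matrix.GeneralLinearGroup.scalar (Fin 3))) ∈ Ω m ↔
      ∀ i j k l, Valued.v (ϖ ^ m * ((g : Matrix (Fin 3) (Fin 3) F) i j * ((g⁻¹ : GL (Fin 3) F) : Matrix (Fin 3) (Fin 3) F) k l)) ≤ 1)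

/-! ## §1  The support of the slice through a mixed companion class -/

omit [CharZero F] [MeasurableSpace F] [BorelSpace F]
  [MeasurableSpace (GL (Fin 3) F)] [BorelSpace (GL (Fin 3) F)] [((Subgroup.zpowers (Units.mk0 ϖ hϖ0)).map (Matrix.GeneralLinearGroup.scalar (Fin 3))).Normal]
  [MeasurableSpace (GL (Fin 3) F ⧸ (Subgroup.zpowers (Units.mk0 ϖ hϖ0)).map (Matrix.GeneralLinearGroup.scalar (Fin 3)))] [BorelSpace (GL (Fin 3) F ⧸ (Subgroup.zpowers (Units.mk0 ϖ hϖ0)).map (Matrix.GeneralLinearGroup.scalar (Fin 3)))] in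
include hϖ hmem in
/-- **(hsupp, mixed) THE SLICE IS SUPPORTED IN `𝔅_{9s₀+L+L_d} · A₃`**, `A₃ = M_{id} ⊓ C(M_{(2,1)}) = {diag(λ,λ,μ)}`: if `θ ≠ 0` only inside `Ω s₀`, `γ = !![0, −N, 0; 1, T, 0; 0, 0, c]`
with `π = X² − TX + N` rootless in `F`, `T, N, c` integral, `|ϖ^L| ≤ |D(γ)| = |(T² − 4N)·π(c)²|` and `|ϖ^{L_d}| ≤ |T² − 4N|`, then `θ(mk(zγz⁻¹)) ≠ 0` forces
`z ∈ 𝔅_{9s₀+L+L_d} · A₃`: `𝔅_{s₀}(zγz⁻¹)` ⇒ `ϖ^{s₀}·zγz⁻¹ = (zD⁻¹)·γ'·(zD⁻¹)⁻¹` integral (§0) ⇒ ★ T18-mixed gives `t ∈ Z(γ')` with `𝔅_{6s₀+L}(zD⁻¹t)` ⇒ ★ glue gives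
`zD⁻¹ ∈ 𝔅_{8s₀+L+L_d}·A₃` ⇒ `z ∈ 𝔅_{9s₀+L+L_d}·A₃` (`D` commutes with `A₃`, `𝔅_{s₀}(D)`). [cite: HarishChandra1970, Part VII §2 Thm 18 + Cor p. 69; §3 pp. 71–72 (`Ω(γ)`)] -/
theorem slice_support_subset_mixed (θ : GL (Fin 3) F ⧸ (Subgroup.zpowers (Units.mk0 ϖ hϖ0)).map (Matrix.GeneralLinearGroup.scalar (Fin 3)) → ℂ) {s₀ : ℕ}
    (hθ : ∀ g, θ g ≠ 0 → g ∈ Ω s₀) {γ : GL (Fin 3) F} {T N c : F} (hγ : (γ : Matrix (Fin 3) (Fin 3) F) = !![0, -N, 0; 1, T, 0; 0, 0, c])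
    (hπ : ∀ r : F, r ^ 2 - T * r + N ≠ 0) (hT : Valued.v T ≤ 1) (hN : Valued.v N ≤ 1) (hc : Valued.v c ≤ 1)
    {L : ℕ} (hD : Valued.v (ϖ ^ L) ≤ Valued.v ((T ^ 2 - 4 * N) * (c ^ 2 - T * c + N) ^ 2))
    {Ld : ℕ} (hdisc : Valued.v (ϖ ^ Ld) ≤ Valued.v (T ^ 2 - 4 * N)) (z : GL (Fin 3) F)
    (hz : θ (QuotientGroup.mk (z * γ * z⁻¹)) ≠ 0) :
    z ∈ {x : GL (Fin 3) F | ∀ i j k l, Valued.v (ϖ ^ (9 * s₀ + L + Ld) * ((x : Matrix (Fin 3) (Fin 3) F) i j * ((x⁻¹ : GL (Fin 3) F) : Matrix (Fin 3) (Fin 3) F) k l)) ≤ 1} *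
      ((standardLeviGL F (id : Fin 3 → Fin 3) ⊓ Subgroup.centralizer ((standardLeviGL F (![0, 0, 1] : Fin 3 → Fin 2) : Subgroup (GL (Fin 3) F)) : Set (GL (Fin 3) F)) :
        Subgroup (GL (Fin 3) F)) : Set (GL (Fin 3) F)) := by
  have hps : ϖ ^ s₀ ≠ 0 := pow_ne_zero _ hϖ0
  have hv1 : Valued.v (ϖ ^ s₀) ≤ 1 := (map_pow _ _ _).trans_le (pow_le_one' (v_le_one_of_v_eq_exp hϖ) _)
  have hball := (hmem s₀ (z * γ * z⁻¹)).1 (hθ _ hz)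
  -- `ϖ^{s₀} · zγz⁻¹` is integral
  have hdet : Valued.v (((z * γ * z⁻¹ : GL (Fin 3) F)) : Matrix (Fin 3) (Fin 3) F).det ≤ 1 := by
    rw [det_conj_companion_eq hγ, map_mul]; exact mul_le_one' hN hc
  have hint := v_pow_mul_apply_le_one_of_adBall hball hdet
  -- the rescaled companion class `γ' = ϖ^{s₀} · D γ D⁻¹`
  set D : GL (Fin 3) F := zpowDiagGL (n := 3) hϖ0 ![(s₀ : ℤ), 0, 0] with hDdef
  set γ' : GL (Fin 3) F := Matrix.GeneralLinearGroup.scalar (Fin 3) (Units.mk0 ϖ hϖ0 ^ s₀) * (D * γ * D⁻¹) with hγ'def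
  have hγ' : (γ' : Matrix (Fin 3) (Fin 3) F) = !![0, -(ϖ ^ s₀ * ϖ ^ s₀ * N), 0; 1, ϖ ^ s₀ * T, 0; 0, 0, ϖ ^ s₀ * c] :=
    coe_scalar_mul_zpowDiagGL_conj hϖ0 hγ s₀
  have hconj : z * D⁻¹ * γ' * (z * D⁻¹)⁻¹ = Matrix.GeneralLinearGroup.scalar (Fin 3) (Units.mk0 ϖ hϖ0 ^ s₀) * (z * γ * z⁻¹) := by
    have h1 : z * D⁻¹ * γ' = Matrix.GeneralLinearGroup.scalar (Fin 3) (Units.mk0 ϖ hϖ0 ^ s₀) * (z * γ * D⁻¹) := by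
      rw [hγ'def, ← mul_assoc (z * D⁻¹), ← Matrix.GeneralLinearGroup.scalar_commute]; group
    rw [h1]; group
  have hy' : ∀ i j, Valued.v ((((z * D⁻¹) * γ' * (z * D⁻¹)⁻¹ : GL (Fin 3) F) : Matrix (Fin 3) (Fin 3) F) i j) ≤ 1 := fun i j => by
    rw [hconj, coe_scalar_mul_apply, Units.val_pow_eq_pow_val, Units.val_mk0]; exact hint i j
  -- hypotheses of ★ T18-mixed ∕ ★ glue for `γ'`
  have hπ' : ∀ r : F, r ^ 2 - ϖ ^ s₀ * T * r + ϖ ^ s₀ * ϖ ^ s₀ * N ≠ 0 := fun r hr => by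
    refine hπ (r / ϖ ^ s₀) ?_
    have h1 : (r / ϖ ^ s₀) ^ 2 - T * (r / ϖ ^ s₀) + N = (r ^ 2 - ϖ ^ s₀ * T * r + ϖ ^ s₀ * ϖ ^ s₀ * N) / (ϖ ^ s₀ * ϖ ^ s₀) := by
      field_simp
    rw [h1, hr, zero_div]
  have hD' : Valued.v (ϖ ^ (6 * s₀ + L)) ≤
      Valued.v (((ϖ ^ s₀ * T) ^ 2 - 4 * (ϖ ^ s₀ * ϖ ^ s₀ * N)) * ((ϖ ^ s₀ * c) ^ 2 - ϖ ^ s₀ * T * (ϖ ^ s₀ * c) + ϖ ^ s₀ * ϖ ^ s₀ * N) ^ 2) := by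
    have h6 : ((ϖ ^ s₀ * T) ^ 2 - 4 * (ϖ ^ s₀ * ϖ ^ s₀ * N)) * ((ϖ ^ s₀ * c) ^ 2 - ϖ ^ s₀ * T * (ϖ ^ s₀ * c) + ϖ ^ s₀ * ϖ ^ s₀ * N) ^ 2 =
        ϖ ^ (6 * s₀) * ((T ^ 2 - 4 * N) * (c ^ 2 - T * c + N) ^ 2) := by ring
    rw [h6, pow_add, map_mul, map_mul]
    exact mul_le_mul' le_rfl hD
  have hT' : Valued.v (ϖ ^ s₀ * T) ≤ 1 := by rw [map_mul]; exact mul_le_one' hv1 hT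
  have hN' : Valued.v (ϖ ^ s₀ * ϖ ^ s₀ * N) ≤ 1 := by rw [map_mul, map_mul]; exact mul_le_one' (mul_le_one' hv1 hv1) hN
  have hπc' : (ϖ ^ s₀ * c) ^ 2 - ϖ ^ s₀ * T * (ϖ ^ s₀ * c) + ϖ ^ s₀ * ϖ ^ s₀ * N ≠ 0 := by
    have h2 : (ϖ ^ s₀ * c) ^ 2 - ϖ ^ s₀ * T * (ϖ ^ s₀ * c) + ϖ ^ s₀ * ϖ ^ s₀ * N = ϖ ^ s₀ * ϖ ^ s₀ * (c ^ 2 - T * c + N) := by ring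
    rw [h2]; exact mul_ne_zero (mul_ne_zero hps hps) (hπ c)
  have hdisc' : Valued.v (ϖ ^ (2 * s₀ + Ld)) ≤ Valued.v ((ϖ ^ s₀ * T) ^ 2 - 4 * (ϖ ^ s₀ * ϖ ^ s₀ * N)) := by
    have h2 : (ϖ ^ s₀ * T) ^ 2 - 4 * (ϖ ^ s₀ * ϖ ^ s₀ * N) = ϖ ^ (2 * s₀) * (T ^ 2 - 4 * N) := by ring
    rw [h2, pow_add, map_mul, map_mul]
    exact mul_le_mul' le_rfl hdisc
  -- ★ T18-mixed and ★ glue at `(zD⁻¹, γ')`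
  obtain ⟨t, ht, hxt⟩ := exists_adBall_mul_centralizer_of_conj_integral_mixed hϖ0 hγ' hπ' hy' hD'
  have hmem' := mem_adBall_mul_A₃_of_comm hγ' hπ' hT' hN' hπc' hdisc' ht hxt
  obtain ⟨b, hb, a₃, ha₃, hba⟩ := Set.mem_mul.1 hmem'
  -- `z = (b·D)·a₃`
  have hcomm : a₃ * D = D * a₃ :=
    mul_comm_of_mem_standardLeviGL_id (Subgroup.mem_inf.1 ha₃).1 (zpowDiagGL_mem_standardLeviGL (id : Fin 3 → Fin 3) hϖ0 _)
  have hbD := adBall_mul hb (adBall_zpowDiagGL_single hϖ hϖ0 s₀)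
  rw [show 6 * s₀ + L + (2 * s₀ + Ld) + s₀ = 9 * s₀ + L + Ld by ring] at hbD
  refine Set.mem_mul.2 ⟨b * D, hbD, a₃, ha₃, ?_⟩
  calc b * D * a₃ = b * a₃ * D := by rw [mul_assoc, ← hcomm, ← mul_assoc]
    _ = z := by rw [hba, inv_mul_cancel_right]

/-! ## §2  The two cusp binders of ★ `cuspForm_cancellation_GL3_blockScalar` for the slice -/

omit [(Valued.v : Valuation F ℤᵐ⁰).Compatible] [MeasurableSpace (GL (Fin 3) F ⧸ (Subgroup.zpowers (Units.mk0 ϖ hϖ0)).map (Matrix.GeneralLinearGroup.scalar (Fin 3)))]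
  [BorelSpace (GL (Fin 3) F ⧸ (Subgroup.zpowers (Units.mk0 ϖ hϖ0)).map (Matrix.GeneralLinearGroup.scalar (Fin 3)))] in
include hρ hsc hBinv in
/-- **(hcusp21, mixed) The slice is a cusp form along `N_{(2,1)}`** — ★ `…_blockScalar`'s binder `hcusp21` VERBATIM (carrier `unipotentRadicalGL F (![0,0,1] : Fin 3 → Fin 2)`): ★ B4-E1
`integral_unipotentRadical21_conj_eq_zero_of_cuspForm` at the regular Levi element `γ` (`χ_{top-left}(c) = π(c) ≠ 0`), fed by the two-sided cusp property of `θ̃` (★ B4-J FILE 4, `Bool`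
labels), then `Bool → Fin 2` (★ FILE 1 §1). [cite: HarishChandra1970, Part VII §2 Thm 20, §8 Lemma 57] [cite: Rogawski1990, §4.13 p. 70] -/
theorem slice_hcusp21_mixed {γ : GL (Fin 3) F} {T N c : F}
    (hγ : (γ : Matrix (Fin 3) (Fin 3) F) = !![0, -N, 0; 1, T, 0; 0, 0, c]) (hπ : ∀ r : F, r ^ 2 - T * r + N ≠ 0)
    (ν₀ : Measure ↥(unipotentRadicalGL F (![0, 0, 1] : Fin 3 → Fin 2))) [ν₀.IsHaarMeasure] (x : GL (Fin 3) F) :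
    ∫ n, (fun z : GL (Fin 3) F => B u' (ρ (QuotientGroup.mk (z * γ * z⁻¹) :
      GL (Fin 3) F ⧸ (Subgroup.zpowers (Units.mk0 ϖ hϖ0)).map (Matrix.GeneralLinearGroup.scalar (Fin 3))) u)) (x * (n : GL (Fin 3) F)) ∂ν₀ = 0 := by
  haveI : T2Space F := (isLocalField F).toT2Space
  have hreg := eval_charpoly_topLeft_of_coe_eq hγ
  have hEq : unipotentRadicalGL F (![false, false, true] : Fin 3 → Bool) = unipotentRadicalGL F (![0, 0, 1] : Fin 3 → Fin 2) :=
    unipotentRadicalGL_eq_of_forall_le_iff fun i j => by fin_cases i <;> fin_cases j <;> decide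
  borelize ↥(unipotentRadicalGL F (![false, false, true] : Fin 3 → Bool))
  refine integral_comp_coe_eq_zero_of_eq hEq
    (fun g : GL (Fin 3) F => B u' (ρ (QuotientGroup.mk ((x * g) * γ * (x * g)⁻¹) :
      GL (Fin 3) F ⧸ (Subgroup.zpowers (Units.mk0 ϖ hϖ0)).map (Matrix.GeneralLinearGroup.scalar (Fin 3))) u)) (fun ν₁ hν₁ => ?_) ν₀
  haveI := hν₁
  have hcusp : ∀ a b : GL (Fin 3) F, ∫ uu : ↥(unipotentRadicalGL F (![false, false, true] : Fin 3 → Bool)),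
      B u' (ρ (QuotientGroup.mk (a * (uu : GL (Fin 3) F) * b) : GL (Fin 3) F ⧸ (Subgroup.zpowers (Units.mk0 ϖ hϖ0)).map (Matrix.GeneralLinearGroup.scalar (Fin 3))) u) ∂ν₁ = 0 :=
    fun a b => integral_sesqForm_apply_translate_unipotentRadicalGL_comp_mk_eq_zero' _ ρ hρ hsc
      (c := (![false, false, true] : Fin 3 → Bool)) ⟨fun t => by rcases Bool.eq_false_or_eq_true t with rfl | rfl <;> [exact ⟨2, rfl⟩; exact ⟨0, rfl⟩], inferInstance⟩
      (by decide) ν₁ hBinv a b u u'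
  have hE := integral_unipotentRadical21_conj_eq_zero_of_cuspForm ν₁ (K2E3GL3MixedConjugacyVolume.leviBlock_mem_standardLeviGL hγ) (by rw [hreg]; exact hπ c)
    (fun g : GL (Fin 3) F => B u' (ρ (QuotientGroup.mk g : GL (Fin 3) F ⧸ (Subgroup.zpowers (Units.mk0 ϖ hϖ0)).map (Matrix.GeneralLinearGroup.scalar (Fin 3))) u))
    hcusp x x⁻¹
  have heq : (fun uu : ↥(unipotentRadicalGL F (![false, false, true] : Fin 3 → Bool)) => B u' (ρ (QuotientGroup.mk ((x * (uu : GL (Fin 3) F)) * γ * (x * (uu : GL (Fin 3) F))⁻¹) :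
        GL (Fin 3) F ⧸ (Subgroup.zpowers (Units.mk0 ϖ hϖ0)).map (Matrix.GeneralLinearGroup.scalar (Fin 3))) u)) =
      fun uu : ↥(unipotentRadicalGL F (![false, false, true] : Fin 3 → Bool)) => B u' (ρ (QuotientGroup.mk (x * ((uu : GL (Fin 3) F) * γ * ((uu : GL (Fin 3) F))⁻¹) * x⁻¹) :
        GL (Fin 3) F ⧸ (Subgroup.zpowers (Units.mk0 ϖ hϖ0)).map (Matrix.GeneralLinearGroup.scalar (Fin 3))) u) := by
    funext uu
    congr 4
    group
  rw [heq]
  exact hE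

omit [(Valued.v : Valuation F ℤᵐ⁰).Compatible] [MeasurableSpace (GL (Fin 3) F ⧸ (Subgroup.zpowers (Units.mk0 ϖ hϖ0)).map (Matrix.GeneralLinearGroup.scalar (Fin 3)))]
  [BorelSpace (GL (Fin 3) F ⧸ (Subgroup.zpowers (Units.mk0 ϖ hϖ0)).map (Matrix.GeneralLinearGroup.scalar (Fin 3)))] in
include hρ hsc hBinv in
/-- **(hcusp21bar, mixed) The slice is a cusp form along `N̄_{(2,1)}`** — ★ `…_blockScalar`'s binder `hcusp21bar` VERBATIM (carrier `unipotentRadicalGL F (![1,1,0] : Fin 3 → Fin 2)`):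
★ B4-E1 `integral_oppositeUnipotentRadical21_conj_eq_zero_of_cuspForm` at `γ`, fed by the two-sided cusp property of `θ̃` along `N̄_{(2,1)}` (★ B4-J FILE 4
`…_opposite_comp_mk_eq_zero`, `N̄_{(2,1)}` = reversal of `N_{(1,2)}`), then `Bool → Fin 2`. [cite: HarishChandra1970, Part VII §2 Thm 20, §8 Lemma 57] [cite: Rogawski1990, §4.13 p. 70] -/
theorem slice_hcusp21bar_mixed {γ : GL (Fin 3) F} {T N c : F}
    (hγ : (γ : Matrix (Fin 3) (Fin 3) F) = !![0, -N, 0; 1, T, 0; 0, 0, c]) (hπ : ∀ r : F, r ^ 2 - T * r + N ≠ 0)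
    (ν₀ : Measure ↥(unipotentRadicalGL F (![1, 1, 0] : Fin 3 → Fin 2))) [ν₀.IsHaarMeasure] (x : GL (Fin 3) F) :
    ∫ n, (fun z : GL (Fin 3) F => B u' (ρ (QuotientGroup.mk (z * γ * z⁻¹) :
      GL (Fin 3) F ⧸ (Subgroup.zpowers (Units.mk0 ϖ hϖ0)).map (Matrix.GeneralLinearGroup.scalar (Fin 3))) u)) (x * (n : GL (Fin 3) F)) ∂ν₀ = 0 := by
  haveI : T2Space F := (isLocalField F).toT2Space
  have hreg := eval_charpoly_topLeft_of_coe_eq hγ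
  have hEq : unipotentRadicalGL F (![true, true, false] : Fin 3 → Bool) = unipotentRadicalGL F (![1, 1, 0] : Fin 3 → Fin 2) :=
    unipotentRadicalGL_eq_of_forall_le_iff fun i j => by fin_cases i <;> fin_cases j <;> decide
  borelize ↥(unipotentRadicalGL F (![true, true, false] : Fin 3 → Bool))
  refine integral_comp_coe_eq_zero_of_eq hEq
    (fun g : GL (Fin 3) F => B u' (ρ (QuotientGroup.mk ((x * g) * γ * (x * g)⁻¹) :
      GL (Fin 3) F ⧸ (Subgroup.zpowers (Units.mk0 ϖ hϖ0)).map (Matrix.GeneralLinearGroup.scalar (Fin 3))) u)) (fun ν₁ hν₁ => ?_) ν₀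
  haveI := hν₁
  have hcusp : ∀ a b : GL (Fin 3) F, ∫ vv : ↥(unipotentRadicalGL F (![true, true, false] : Fin 3 → Bool)),
      B u' (ρ (QuotientGroup.mk (a * (vv : GL (Fin 3) F) * b) : GL (Fin 3) F ⧸ (Subgroup.zpowers (Units.mk0 ϖ hϖ0)).map (Matrix.GeneralLinearGroup.scalar (Fin 3))) u) ∂ν₁ = 0 :=
    fun a b => integral_sesqForm_apply_translate_unipotentRadicalGL_opposite_comp_mk_eq_zero _ ρ hρ hsc (c₁ := (![false, true, true] : Fin 3 → Bool))
      (c₂ := (![true, true, false] : Fin 3 → Bool))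
      ⟨fun t => by rcases Bool.eq_false_or_eq_true t with rfl | rfl <;> [exact ⟨1, rfl⟩; exact ⟨0, rfl⟩], inferInstance⟩ (by decide)
      (fun i => by fin_cases i <;> rfl) ν₁ hBinv a b u u'
  have hE := integral_oppositeUnipotentRadical21_conj_eq_zero_of_cuspForm ν₁ (K2E3GL3MixedConjugacyVolume.leviBlock_mem_standardLeviGL hγ) (by rw [hreg]; exact hπ c)
    (fun g : GL (Fin 3) F => B u' (ρ (QuotientGroup.mk g : GL (Fin 3) F ⧸ (Subgroup.zpowers (Units.mk0 ϖ hϖ0)).map (Matrix.GeneralLinearGroup.scalar (Fin 3))) u))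
    hcusp x x⁻¹
  have heq : (fun vv : ↥(unipotentRadicalGL F (![true, true, false] : Fin 3 → Bool)) => B u' (ρ (QuotientGroup.mk ((x * (vv : GL (Fin 3) F)) * γ * (x * (vv : GL (Fin 3) F))⁻¹) :
        GL (Fin 3) F ⧸ (Subgroup.zpowers (Units.mk0 ϖ hϖ0)).map (Matrix.GeneralLinearGroup.scalar (Fin 3))) u)) =
      fun vv : ↥(unipotentRadicalGL F (![true, true, false] : Fin 3 → Bool)) => B u' (ρ (QuotientGroup.mk (x * ((vv : GL (Fin 3) F) * γ * ((vv : GL (Fin 3) F))⁻¹) * x⁻¹) :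
        GL (Fin 3) F ⧸ (Subgroup.zpowers (Units.mk0 ϖ hϖ0)).map (Matrix.GeneralLinearGroup.scalar (Fin 3))) u) := by
    funext vv
    congr 4
    group
  rw [heq]
  exact hE

/-! ## §3  The per-point `hcanc` at a mixed regular class -/

variable (hK : ∀ (m : ℕ) (k : GL (Fin 3) F), k ∈ glInt 3 F → ∀ x : GL (Fin 3) F ⧸ (Subgroup.zpowers (Units.mk0 ϖ hϖ0)).map (Matrix.GeneralLinearGroup.scalar (Fin 3)),
    ((QuotientGroup.mk k : GL (Fin 3) F ⧸ _) * x ∈ Ω m ↔ x ∈ Ω m) ∧ (x * (QuotientGroup.mk k : GL (Fin 3) F ⧸ _) ∈ Ω m ↔ x ∈ Ω m))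
  (μ' : Measure (GL (Fin 3) F ⧸ (Subgroup.zpowers (Units.mk0 ϖ hϖ0)).map (Matrix.GeneralLinearGroup.scalar (Fin 3)))) [μ'.IsHaarMeasure]

include hϖ hρ hsc hBinv hmem hK in
/-- **THE PER-POINT `hcanc` AT A MIXED REGULAR CLASS `ḡ = mk (y γ y⁻¹)`**: `γ = !![0, −N, 0; 1, T, 0; 0, 0, c]` (`π = X² − TX + N` rootless, `T, N, c` integral, depths
`|ϖ^L| ≤ |(T² − 4N)π(c)²|`, `|ϖ^{L_d}| ≤ |T² − 4N|`), `𝔅_s(y)`, `θ = B u' (ρ · u)` supported in `Ω s₀`; then for EVERY `n`,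
`∫_{Ω n} θ(x̄ ḡ x̄⁻¹) dμ'(x̄) = ∫_{Ω n ∩ Ω R} θ(x̄ ḡ x̄⁻¹) dμ'(x̄)` with `R = m_C + (1 + 2s + 4m_C) + s`, `m_C = 9s₀ + L + L_d` — ★ (C) `cuspForm_cancellation_GL3_blockScalar` (`m = 1`)
with §1–§2, descended by ★ (C-shell A). [cite: HarishChandra1970, Part VII §2 Thm 20 p. 70, §3 pp. 71–73] [cite: Casselman1995, Thm. 5.3.1] -/
theorem setIntegral_conj_eq_setIntegral_inter_mixed {s₀ : ℕ}
    (hθ : ∀ g : GL (Fin 3) F ⧸ (Subgroup.zpowers (Units.mk0 ϖ hϖ0)).map (Matrix.GeneralLinearGroup.scalar (Fin 3)), B u' (ρ g u) ≠ 0 → g ∈ Ω s₀)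
    {γ : GL (Fin 3) F} {T N c : F} (hγ : (γ : Matrix (Fin 3) (Fin 3) F) = !![0, -N, 0; 1, T, 0; 0, 0, c]) (hπ : ∀ r : F, r ^ 2 - T * r + N ≠ 0)
    (hT : Valued.v T ≤ 1) (hN : Valued.v N ≤ 1) (hc : Valued.v c ≤ 1)
    {L : ℕ} (hD : Valued.v (ϖ ^ L) ≤ Valued.v ((T ^ 2 - 4 * N) * (c ^ 2 - T * c + N) ^ 2))
    {Ld : ℕ} (hdisc : Valued.v (ϖ ^ Ld) ≤ Valued.v (T ^ 2 - 4 * N))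
    {s : ℕ} {y : GL (Fin 3) F} (hy : ∀ i j k l, Valued.v (ϖ ^ s * ((y : Matrix (Fin 3) (Fin 3) F) i j * ((y⁻¹ : GL (Fin 3) F) : Matrix (Fin 3) (Fin 3) F) k l)) ≤ 1)
    (n : ℕ) :
    ∫ x in Ω n, B u' (ρ (x * QuotientGroup.mk (y * γ * y⁻¹) * x⁻¹) u) ∂μ' =
      ∫ x in Ω n ∩ Ω ((9 * s₀ + L + Ld) + (1 + 2 * s + 4 * (9 * s₀ + L + Ld)) + s), B u' (ρ (x * QuotientGroup.mk (y * γ * y⁻¹) * x⁻¹) u) ∂μ' := by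
  haveI : SecondCountableTopology (GL (Fin 3) F) := K2E3GL3ModCentre.secondCountableTopology_gl3 F
  haveI : LocallyCompactSpace (GL (Fin 3) F) := K2E3GL3ModCentre.locallyCompactSpace_gl3 F
  set μ : Measure (GL (Fin 3) F) := Measure.haar with hμ
  have hθc : Continuous fun g : GL (Fin 3) F ⧸ (Subgroup.zpowers (Units.mk0 ϖ hϖ0)).map (Matrix.GeneralLinearGroup.scalar (Fin 3)) => B u' (ρ g u) :=
    ((Representation.IsSmooth.isLocallyConstant_apply ρ hρ u).comp fun w : V => B u' w).continuous
  refine setIntegral_conj_eq_setIntegral_inter_of_cuspForm_cancellation hϖ hϖ0 μ μ' Ω hmem hK (fun g => B u' (ρ g u)) hθc γ y (fun x hx => ?_) n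
  exact cuspForm_cancellation_GL3_blockScalar hϖ μ (le_refl 1) hy
    (fun z : GL (Fin 3) F => B u' (ρ (QuotientGroup.mk (z * γ * z⁻¹) : GL (Fin 3) F ⧸ (Subgroup.zpowers (Units.mk0 ϖ hϖ0)).map (Matrix.GeneralLinearGroup.scalar (Fin 3))) u))
    (continuous_slice _ ρ hρ γ u u') (fun z hz => slice_support_subset_mixed hϖ hϖ0 Ω hmem _ hθ hγ hπ hT hN hc hD hdisc z hz)
    (fun ν₀ hν₀ x' => by haveI := hν₀; exact slice_hcusp21_mixed hϖ0 ρ hρ hsc hBinv u u' hγ hπ ν₀ x')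
    (fun ν₀ hν₀ x' => by haveI := hν₀; exact slice_hcusp21bar_mixed hϖ0 ρ hρ hsc hBinv u u' hγ hπ ν₀ x') hx

include hϖ hρ hsc hBinv hmem hK in
/-- **THE RADIUS PACKAGE FOR ASM, MIXED BRANCH ((M16-2), per-point form)**: there is a support height `s₀` of `θ = B u' (ρ · u)` such that for EVERY mixed companion `γ` as above
(depths `L`, `L_d`), every `y` with `𝔅_s(y)` and every `n`: `∫_{Ω n} θ(x̄·mk(yγy⁻¹)·x̄⁻¹) dμ' = ∫_{Ω n ∩ Ω R} …`, `R = (9s₀+L+L_d) + (1 + 2s + 4(9s₀+L+L_d)) + s` (linear in the depths).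
[cite: HarishChandra1970, Part VII §3 pp. 72–73 (`Ω(γ)`)] -/
theorem exists_radius_setIntegral_conj_eq_setIntegral_inter_mixed :
    ∃ s₀ : ℕ, ∀ {γ : GL (Fin 3) F} {T N c : F}, (γ : Matrix (Fin 3) (Fin 3) F) = !![0, -N, 0; 1, T, 0; 0, 0, c] → (∀ r : F, r ^ 2 - T * r + N ≠ 0) →
      Valued.v T ≤ 1 → Valued.v N ≤ 1 → Valued.v c ≤ 1 → ∀ {L : ℕ}, Valued.v (ϖ ^ L) ≤ Valued.v ((T ^ 2 - 4 * N) * (c ^ 2 - T * c + N) ^ 2) →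
      ∀ {Ld : ℕ}, Valued.v (ϖ ^ Ld) ≤ Valued.v (T ^ 2 - 4 * N) →
      ∀ {s : ℕ} {y : GL (Fin 3) F}, (∀ i j k l, Valued.v (ϖ ^ s * ((y : Matrix (Fin 3) (Fin 3) F) i j * ((y⁻¹ : GL (Fin 3) F) : Matrix (Fin 3) (Fin 3) F) k l)) ≤ 1) →
      ∀ n : ℕ, ∫ x in Ω n, B u' (ρ (x * QuotientGroup.mk (y * γ * y⁻¹) * x⁻¹) u) ∂μ' =
        ∫ x in Ω n ∩ Ω ((9 * s₀ + L + Ld) + (1 + 2 * s + 4 * (9 * s₀ + L + Ld)) + s), B u' (ρ (x * QuotientGroup.mk (y * γ * y⁻¹) * x⁻¹) u) ∂μ' := by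
  obtain ⟨s₀, hs₀⟩ := exists_support_height hϖ hϖ0 ρ hρ hsc hBinv u u' Ω
  exact ⟨s₀, fun hγ hπ hT hN hc _ hD _ hdisc _ _ hy n =>
    setIntegral_conj_eq_setIntegral_inter_mixed hϖ hϖ0 ρ hρ hsc hBinv u u' Ω hmem hK μ' hs₀ hγ hπ hT hN hc hD hdisc hy n⟩

end Summit.HodgeConjecture.HodgeConjecture.Cruxes.H413.K2E3GL3SupercuspOrbitalSliceCancellationMixed

end
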